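import Mathlib
import HarnessLib
import HarnessLib.Audit
import Summits.PneNP.Statement
import Literature.Computability.Complexity.Classes
import Literature.Computability.Complexity.Nondeterministic
import Literature.Computability.Complexity.PaulPippengerSzemerediTrotter1983LogStar

/-!
Route: RootDecompSegregator

DORMANT since 2026-09-04T13:18:08Z (reconciler: no traction for 5 d (last activity statement-checked at 2026-08-30T12:31:19Z); parked, not closed — `ledger route dormant route-PneNP-RootDecompSegregator --off` to reactivate) — unstaffed, not closed; items shared with open routes are served there. `ledger route dormant <id> --off` reactivates.

# Route RootDecompSegregator — Root decomposition on the equal-exponent dial — REV 3: the rung moved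
to n·log* n (NTIME(n log* n) ⊄ DTIME(n log* n)) after K** killed the segregator road at n log n,
plus the lift

REV 3 (writer g4, 2026-08-30; lens-1 g5 «SpeedupWindow», HOME/decomp-pnenp-lens-1/SpeedupWindow.lean
sha256 87c12ba8…, NODE-g5.md 6289d3e1…; critic decomp-pnenp-crit-1 CLEARED 2026-08-30T06:10:39Z as
N7 REPAIR CONTENT, no new cut score; K** = `¬ SmallSegregators` kernel-checked by crit-1/lens-1 g4
(every page r ≥ 3), refutation of stmt-PneNP-26297 landing as p763541): the node MOVES ONE RUNG DOWN
the equal-exponent dial, from t = n·log n to the FIRST OPEN RUNG t* = n·(log* n + 1). It suffices to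
show
X = Sh* ∧ C* where Sh* = `EqExpRungLogStar` (NTIME(n·(log* n+1)) ⊄ DTIME(n·(log* n+1)) on the tree's
multi-stack machines; `logStar` = the tree's iterated logarithm
`Literature.Computability.Complexity.logStar`; O-slack built into DTIME, so this is DTIME(n log* n)
≠ NTIME(n log* n) of print — S-implied (lens kernel `eqExpRungLogStar_of_pneNP` mod the routine
constructibility conjunct), OPEN since Santhanam 2001 Thm 2.5 which stops at t = o(n log* n)) and C*
= `EqExpResidualStar` (the DECLARED RESIDUAL Sh* → S). Exact carving S ⟺ Sh* ∧ C* (lens kernel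
`node_iff`). `closes (hSh : EqExpRungLogStar) (hRes : EqExpResidualStar) : PneNP := hRes hSh`
(trivial seam, flagged; content in the pieces and in the ROAD beneath Sh*, see NOT DECOMPOSED YET).
The rev-0/rev-2 pieces EqExpRungLog (26196, rung n log n) and EqExpResidual (26197) stay in the file
as NAMED-OPEN ASIDES of record (by upward padding Sh_log ⟹ Sh* and C* ⟹ EqExpResidual, both mod
window data): the h = log rung is not refuted, only its segregator ROAD is (SmallSegregators 26297 /
SmallSegregatorsAt3 27086 = settled negatives once p763541 lands; SegregatorLift 26298
vacuous-provable; glue 26299 moot).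
Lean: `(¬ (Literature.Computability.Complexity.NTIME (fun n => n *
(Literature.Computability.Complexity.logStar n + 1)) ⊆ Literature.Computability.Complexity.DTIME
(fun n => n * (Literature.Computability.Complexity.logStar n + 1)))) ∧ ((¬
(Literature.Computability.Complexity.NTIME (fun n => n *
(Literature.Computability.Complexity.logStar n + 1)) ⊆ Literature.Computability.Complexity.DTIME
(fun n => n * (Literature.Computability.Complexity.logStar n + 1)))) → PneNP)`

RECORD (rev 0–2 thesis, superseded as to the cone, kept verbatim for the ledger):

Root-decomposition cell decomp-pnenp, node N7 (lens-1 gen 3 «SegregatorMagnification»,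
HOME/decomp-pnenp-lens-1/SegregatorMagnification.lean
sha256 d57d7a0c…, NODE-g3.md sha256 2bcabdd6…; critic decomp-pnenp-crit-1 CLEARED
2026-08-30T02:53:22Z, filing shape (b)). REV 2 (gen 3, 2026-08-30): lens-1 g4
«SegregatorPageThreshold» (HOME/decomp-pnenp-lens-1/SegregatorPageThreshold.lean sha256
37dafcbd778e7dfbb2f8133376f4ed63fbdea823…; NODE-g4.md), critic CLEARED 2026-08-30T03:44:40Z as a
REVISION of the ROAD (same node and items; no new score): the road item SmallSegregators (26297) is
read as the PAGE DIAL ∀ r, SmallSegregatorsAt r — calibrated through r = 2 (A(0) kernel; A(1), A(2)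
print mod the one binder PlanarDivision), OPEN POINT r = 3 filed as the record aside
SmallSegregatorsAt3, new kernel theorem cut_segregable (across-a-cut expanders are segregable for
every r — separator deaths GKS89/DW10/BY13 do not kill segregators), kill road DepthRobust ⟹
AncestorRobust ⟹ ¬A(r), and the ENDORSED refuter target K* (Schnitger ∘ PPST83 Thm 5.2 ∘ Valiant-EUG
dilation ⟹ ¬A(3)): 26297 PREDICTED FALSE ≈0.6 — operator: refuter/cdisprove seat on 26297 BEFORE
provers on 26297/26298; road ≠ piece (N7 = EqExpRungLog ∧ EqExpResidual untouched if the road dies).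
It suffices to show
X = Sh ∧ C where Sh = `EqExpRungLog` (the equal-exponent rung at t = n log n: NTIME(n·ℓn) ⊄
DTIME(n·ℓn) on the tree's multi-stack machines,
ℓn = ⌊log₂ n⌋ + 1 — an S-implied shadow, OPEN in print) and C = `EqExpResidual` (the declared
residual Sh → S). The node is the exact law-D split
S ⟺ Sh ∧ (Sh → S) (cell file `pneNP_iff_shadow`, modulo the tree theorem
`soloInformed_pneNP_iff_forall_not_NTIME_id_subset_DTIME_pow` carried as a
binder only because its module is unbuilt today). Beneath Sh the route carries the cell's first
typed, barrier-free, NON-complexity attack surface: the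
ROAD Sh ⟸ SmallSegregators ∧ SegregatorLift (Santhanam's (o(n), o(n/log n)) segregator hypothesis
for multi-pushdown graphs — pure finite graph theory —
and his Theorem 2.7), filed right after birth as a glued split of Sh (items SmallSegregators crux +
SegregatorLift support + glue).
Lean: `¬ (Literature.Computability.Complexity.NTIME (fun n => n * (Nat.log 2 n + 1)) ⊆
Literature.Computability.Complexity.DTIME (fun n => n * (Nat.log 2 n + 1))) ∧ (¬
(Literature.Computability.Complexity.NTIME (fun n => n * (Nat.log 2 n + 1)) ⊆
Literature.Computability.Complexity.DTIME (fun n => n * (Nat.log 2 n + 1))) → PneNP)`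

## Assembly
Pure logic: `EqExpResidual` consumes `EqExpRungLog` and returns `PneNP`; the deciding theorem
`closes` is `hRes hSh` (trivial seam, flagged — the
content sits in the pieces and in the road beneath Sh). Conversely S implies both items (cell file
`pneNP_iff_shadow` modulo the in-tree time-ladder
equivalence), so the split is exact and the residual is the T1′ conjunct-complement of the shadow.

Rationale: WHY THIS LINE. REV 3: after K** the segregator road to the rung h = log is dead in kernel and PPST
§5 Thm 5.1 caps EVERY pebbling road below gain log N [corpus:paper-url-5a4c0b3a5ba8 p.8 «the factor
log* N in Theorem 2.1 might be replaced by a larger factor … at most log N»]; lens-1 g5 re-targets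
the node to the FIRST OPEN RUNG h = log* (Santhanam 2001 Thm 2.5 stops at t = o(n log* n)
[corpus:paper-doi-10-1109-ccc-2001-933895 p.4 L87–88]; «a proof that DTIME(n log n) ≠ NTIME(n log n)
would indeed be interesting» ibid. L28–29; re-confirmed open by Salamon–Wehar 2023
[graph:arxiv:2111.02138]) and supplies the missing kernel object: the ALTERNATION-SPEEDUP LIFT AT A
SUPERLINEAR LEVEL (`not_collapseAt_of_speedUp`, 0 sorry), so the road is typed in the tree's own
currency DTIME(n·f) ⊆ ΣₖLIN (gain f = (log*)³ inside PPST's open engine window (log*, log)) instead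
of the refuted segregator currency. Rev 0–2 record follows. Every gen-0/gen-2 node of the cell is a
law-D normal form with zero leaves attackable toward S; the critic's scoring rule asks for a typed
attack surface
under a necessary shadow. Lens-1 g3 moved the magnification threshold OFF the unified time-exponent
dial (B_k / GapFine ε / TimeRung k, one dial with
three charts) onto a COMBINATORIAL object: the segregator size of r-pushdown DAGs (PaulEtAl1983 Thm
2.1; Santhanam2001 §2, Thm 2.5, Thm 2.7
[corpus:paper:doi-10-1109-ccc-2001-933895 p.4]). The shadow DTIME(n log n) ≠ NTIME(n log n) is
necessary for S (kernel `eqExpRungLog_of_pneNP`), open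
(Santhanam 2001 p.4; Salamon–Wehar arXiv:2111.02138 §3: nothing is known from n·log* n on),
bracketed by a DECIDED rung below (the tree's proved
`segregator_theorem`, log* gain, module unbuilt) and a REFUTED rung above ((o(n/log n), o(n/log n))
segregators do not exist for some pushdown families,
PPST as reported by Santhanam p.4). Imported area: extremal graph theory / pebbling (depth-robust
graphs Erdős–Graham–Szemerédi 1975, Schnitger 1983,
Alwen–Blocki–Pietrzak 2017; pushdown expanders Dvir–Wigderson 2010 from Bourgain 2009) — the road's
kill switch is an ancestor-robust constant-page DAG
family (cell file `not_smallSegregators_of_ancestorRobust`). What no prior route does: a root node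
whose non-residual side bottoms out in a finite
combinatorial statement no catalogued barrier quantifies over; the zero-sum price (residual C
formally STRONGER than lens-3's QuadTimeRung → S) is declared.

RANKED CRUXES. #2 EqExpRungLogStar (crux, REV 3, attacked) — Sh* — nondeterministic time n·(log* n +
1) is not contained in deterministic time n·(log* n + 1) on the tree's multi-stack machines (=
DTIME(n log* n) ≠ NTIME(n log* n) of print, O-slack built in); S-implied (lens kernel
`eqExpRungLogStar_of_pneNP`, via `not_collapseAt_of_P_ne_NP`: every polynomially bounded
equal-exponent rung is S-implied); converse = the declared residual; OPEN since Santhanam 2001 Thm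
2.5; leaf IDEA-NEEDED-with-TYPED-ROAD (Sh* ⟸ SpeedUpPolyLogStar ∧ LogStarWindowData, glue PROVED in
the lens kernel `eqExpRungLogStarGlue_holds`; road items typed against the TREE's `sigmaLin` only —
module …PaulPippengerSzemerediTrotter1983Collapse farm-unbuilt today ⇒ filed when the olean exists,
critic: vendoring = birth-blocker). [difficulty: open-problem] (why it might fail: cannot fail short
of P = NP (S ⟹ Sh*); as a target every known engine gives gain exactly log* n (PPST Thm 3, Gupta k =
2), one factor short after the translation loss.) [Santhanam2001, PaulEtAl1983, AroraBarakCC2009,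
arXiv:2111.02138]
#3 EqExpResidualStar (crux, REV 3, DECLARED RESIDUAL) — C* — one equal-exponent separation at the
quasi-linear rung n·log* n lifts to P ≠ NP; S-implied trivially; false exactly if DTIME(n log* n) ≠
NTIME(n log* n) but P = NP, consistent with everything known (relativized worlds with P = NP exist,
BGS75; census CLAIM C ORACLE-FALSE tag, confidence 0.8); formally STRONGER than EqExpResidual
(26197) and than WCSL's CornerLift (the shadow moved DOWN again: zero-sum price declared, no
residual score); inherits every barrier of the summit. [deps: EqExpRungLogStar] [difficulty:
open-problem] (why it might fail: it is the summit in disguise whenever the shadow is a theorem; no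
road in print.) [Santhanam2001, BakerGillSolovay1975, AaronsonWigderson2009, RazborovRudich1997,
arXiv:2111.02138]
#9 EqExpRungLog (aside since REV 3; was #2) — the rung h = log: NTIME(n·ℓn) ⊄ DTIME(n·ℓn), ℓn =
⌊log₂ n⌋+1 — NAMED-OPEN aside of record, STRONGER than Sh* by upward padding; its segregator road
(split children SmallSegregators 26297 crux-201 / SegregatorLift 26298 / glue 26299, aside
SmallSegregatorsAt3 27086) is DEAD: K** (`¬ SmallSegregators`, every page r ≥ 3; refutation p763541
on 26297) — 26297/27086 settled negatives on landing, 26298 vacuous-provable, 26299 moot.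
[Santhanam2001, PaulEtAl1983, arXiv:2111.02138, HomerSelman2011]
#9 EqExpResidual (aside since REV 3; was #3) — EqExpRungLog → S — NAMED-OPEN aside of record, WEAKER
than C* (C* ⟹ it mod window data); meets the alternation chain: ⟹ N14's UniformCollapse mod
FortnowCompounding (lens-6 g6 kernel `uniformCollapse_of_eqExpResidual`). [Santhanam2001,
BakerGillSolovay1975, AaronsonWigderson2009, arXiv:2111.02138]
#9 SmallSegregatorsAt3 (aside, rev 2) — the page dial's OPEN POINT r = 3 (26297 with the page number
fixed to 3; writer Iff.rfl cert bc/N7v2_items.lean; BC7 CLEAN); the REFUTER's K* target; ¬it ⟹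
¬SmallSegregators. [corpus:doi-10-1109-ccc-2001-933895, corpus:doi-10-1007-bf02122679,
corpus:doi-10-4086-toc-2010-v006a012]
TWO-LAYER PLAN. REV 3 ROAD under Sh* (lens-1 g5, kernel glue proved; items to be filed as a glued
split of EqExpRungLogStar once the tree module …PaulPippengerSzemerediTrotter1983Collapse is BUILT
on the farm — they need the tree's `sigmaLin`/`linExists`): SpeedUpPolyLogStar (crux 201, UNDECIDED
ROAD, incomparable with S: `∃ k, DTIME (fun n => n * (logStar n + 1) ^ 3) ⊆ sigmaLin k` —
deterministic time n·(log* n+1)³ is simulated by Σₖ machines in linear time with linearly many guess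
bits; print: gain log* with k = 4 (PPST 1983 Thm 3) and k = 2 (Gupta) TRUE one power below, gain
(log*)³ OPEN («log* N … might be replaced by a larger factor», PPST p.436); engines give gains < log
N only (PPST Thm 5.1), so (log*)³ sits inside the open engine window (log*, log); the K** witnesses
are segregable at this budget (periodic level deletion) so K** does NOT bear on it; why it might
fail: a time-n(log*)³ 3-stack machine whose computation graphs resist every constant-alternation
block-respecting resimulation with o(n) guessed bits) ∧ LogStarWindowData (support 202,
TRUE-routine, ≈300–500 lines of clock code: t* time-constructible, linearly dilating `LinDilation`,
padding level g = n·(log* n+1)² fits the window) with glue EqExpRungLogStarGlue (203) =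
`SpeedUpPolyLogStar → LogStarWindowData → EqExpRungLogStar`, PROVED (`eqExpRungLogStarGlue_holds`,
axioms standard) via the lens toolkit `linExists_DTIME_subset_NTIME`,
`sigmaLin_subset_DTIME_of_collapseAt`, `NTIME_subset_DTIME_of_collapseAt`,
`not_collapseAt_of_speedUp` — landable verbatim as Theorems/RootDecompSpeedupWindowGlue.lean (≤
400-line split) by a prover once Collapse builds. Engine-layer asides (banked, never in cone):
SmallSegregatorsLogStarCubed (SegAt (log*+1)³, UNDECIDED/INSTRUMENTABLE), SegregatorLiftLogStarCubed
(print-analogous). Rev-2 record follows. REV 2: page dial under the road — A ⟺ ∀ r ≥ 3, A(r)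
(kernel), A(≤2) decided mod PlanarDivision, kill road DepthRobust r c δ ⟹ ¬A(r′ ≥ r) (kernel), K*
pending on A(3) (aside SmallSegregatorsAt3). EqExpRungLog ⇐ SmallSegregators (crux, child; pure
graph theory: ∀ r k ∃ N₀ ∀ N ≥ N₀, every H_r(N) multi-pushdown edge set has a vertex set J with
(k+1)·|J|·ℓN ≤ N outside which every vertex has ≤ N/(k+1) J-avoiding ancestors — typed inline over
Finset/Relation.TransGen/Set.ncard, verbatim the
olean-less tree defs IsPushdownFamily/IsMultiPushdownGraph/ancestorsAvoiding/IsSegregator; writer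
certificate bc/N7_Segregator_items.lean, Iff.rfl) ∧
SegregatorLift (support, child; Santhanam 2001 Thm 2.7, theorem in print, kernel debt Lemmas 2.2/2.3
+ (o(n), o(n/log n)) simulation + multitape ↦ TM2 via
the tree's H_{4K} walkEdges) with glue SmallSegregators → SegregatorLift → EqExpRungLog (modus
ponens) — filed by `ledger route edit --split EqExpRungLog`
immediately after birth (critic F4 shape (b)). Under SmallSegregators: decided rung SegregatorRung
log* (tree `segregator_theorem`, by name once rebuilt);
kill switch AncestorRobust r c δ → ¬SmallSegregators (cell kernel); instrument (census g3, ≈ 10–20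
core-h, one batched job): min |J| by ILP/MaxSAT for
N ≤ 2048, r ∈ {2,3} on random / DW10 monotone-expander / multi-scale families (growth evidence for
AncestorRobust only; finite ratios cannot support A).

KILL CRITERIA. REV 3: a refutation of EqExpRungLogStar or EqExpResidualStar refutes P ≠ NP itself
(both kernel consequences of S); the road dies (not the node) on a landed ¬SpeedUpPolyLogStar (a
time-n(log*)³ multi-stack family with no constant-alternation o(n)-guess resimulation) — repair =
next gain inside the window or `exhausted`; the route closes `superseded` if a node isolates a
residual weaker than EqExpResidualStar with an attack surface at least as concrete (WCSL's
CornerLift is WEAKER — recorded, not superseding: its shadow QuadTimeRung has no typed road). Rev-2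
record: A refutation of EqExpRungLog or EqExpResidual refutes P ≠ NP itself (both are kernel
consequences of S), so the route cannot close `refuted:` on its
load-bearing items without deciding the summit. A landed ¬SmallSegregators (an ancestor-robust
constant-page pushdown family) kills the ROAD, not the node:
repair = drop the split children, keep Sh and C (critic F4). The route closes `superseded` if a node
isolates a residual weaker than EqExpResidual with an
attack surface at least as concrete, and `exhausted` if the census instrument plus the
depth-robust-graph literature settle AncestorRobust positively and
no second road to Sh is typed.

NOT DECOMPOSED YET. REV 3: the ROAD items SpeedUpPolyLogStar / LogStarWindowData /
EqExpRungLogStarGlue are NOT filed in this revision (typed against the tree's `sigmaLin` whose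
module is farm-unbuilt; critic 06:10:39Z: items vs TREE decls only = pending-olean, never vendored)
— TREE.md debt; kernel edge `eqExpRungLogStar_of_eqExpRungLog` (26196 ⟹ Sh* by padding) requested of
lens-1 (F1). Rev-2 record: REV 2: PlanarDivision (Lipton–Tarjan ε-division for 2-page graphs) is a
print binder in the lens file, not an item; AncestorRobust / DepthRobust / CutBipartite and the kill
switches are lens kernel theorems landable as Theorems/RootDecompSegregator/{Support,Negative} files
(--supports 26297), not items. The Santhanam engine (guess-bounded hierarchy Lemma 2.2, refined
collapse Lemma 2.3, the (o(n), o(n/log n))-segregator speed-up) is Literature work, not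
items; the binder TimeLadderEquiv (= tree theorem
`soloInformed_pneNP_iff_forall_not_NTIME_id_subset_DTIME_pow`, module unbuilt) is discharged by name
once
rebuilt and is not needed by `closes`; the census-B2 rung B₁ = SAT ∉ DTIME(n) (stmt-PneNP-1641) is
deliberately NOT re-typed (it lies beyond the segregator
family even granting SmallSegregators — NODE-g3 §5 certificate, accepted by the critic as a
barrier-leaf certificate); AncestorRobust and the
SegregatorRung dial are docstring-level roads, not items.

CHEAPEST FALSIFIER. REV 3: lookup — is DTIME(n log* n) ≠ NTIME(n log* n) decided in print? Santhanam
2001 Thm 2.5 [corpus:paper-doi-10-1109-ccc-2001-933895 p.4] decides only t = o(n·log* n);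
Salamon–Wehar [graph:arxiv:2111.02138 §3]: nothing known from n·lg* n on; galaxy
`segregator|alternation-trading|n log* n` --star all → 36 rows, 0 relevant (null); citation graph of
Santhanam 2001 (18 citers) → none improves Thm 2.5 ⇒ Sh* OPEN as stated. In tree: BC2 battery on
`EqExpRungLogStar → PneNP`, `PneNP → EqExpRungLogStar`, `EqExpRungLogStar`, `¬EqExpRungLogStar`,
`EqExpResidualStar → PneNP` — all FAIL (n18_speedup/N7w1_bc2.lean rc 1, 5 unsolved goals); BC7 CLEAN
×2. Rev-2 record: Lookup: is DTIME(n log n) ≠ NTIME(n log n) (multitape / multi-stack) already a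
theorem or refuted in print? Ran it: [corpus:paper:doi-10-1109-ccc-2001-933895 p.4]
(Santhanam, CCC 2001) proves DTIME(o(n·log* n))-type separations (Thm 2.5) and states Thm 2.7
conditionally, calling an unconditional proof at n log n
«interesting» (open); arXiv:2111.02138 §3 (Salamon–Wehar) confirms nothing is known for t ≥ n·lg* n;
[corpus:book:homer2011-computability-complexity-theory
p.84 §5.2] «for most time bounds the question is open». The shadow is open, the line stands.
Tree-level typing falsifier: the BC2 battery on
`EqExpRungLog → PneNP` and `EqExpResidual → PneNP` must fail — it does (bc/N7_bc2_probes.lean).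

NUMBERS. REV 3: equal-exponent dial t ↦ [NTIME(t) ⊄ DTIME(t)]: t = n DECIDED (PPST83, tree fact), t
= o(n·log* n) DECIDED (Santhanam Thm 2.5), t = n·log* n = Sh* FILED (first open rung), t = n·log n =
26196 aside; speed-up dial DTIME(n·f) ⊆ ΣₖLIN: f = log* TRUE (k = 4 PPST Thm 3; k = 2 Gupta), f =
(log*)³ = SpeedUpPolyLogStar OPEN, f = log = ceiling of pebbling engines (PPST Thm 5.1) and K** in
kernel for the 2-round segregator form. Rev-2 record: Equal-exponent dial t ↦ [NTIME(t) ⊄ DTIME(t)]: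
t = n DECIDED (PPST 1983; tree fact `PaulEtAl1983_NTIME_not_subset_DTIME`, in-tree programme one
hypothesis from closed); t = o(n·log* n) decided (Santhanam 2001 Thm 2.5); every t ≥ n·log* n OPEN
(Salamon–Wehar 2023 §3). Segregator dial: gain log* DECIDED
in tree (`segregator_theorem`, PPST Thm 2.1: (O(n/log* n), O(n/log* n))); gain (o(n), o(n/log n)) =
SmallSegregators OPEN; (o(n/log n), o(n/log n)) REFUTED
(PPST, per Santhanam p.4). Valiant 1977: depth ≤ N/(k+1) always achievable by removing O(N log k /
log N) edges — SmallSegregators is exactly the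
ancestors-vs-depth gap on constant-page DAGs (critic F2).

DEFINITION REQUESTS. None filed for this route: the four segregator predicates are VERBATIM copies
of tree decls of the olean-less module
`Literature.Computability.Complexity.PaulPippengerSzemerediTrotter1983Segregators` inlined into the
child statement (critic F4: admissible now, precedent
N2 rev 1; swap to imports when the module is rebuilt — olean rebuild owed, TREE.md §Debts D4).

Novelty: Searches (2026-08-30): lit search --hybrid "Santhanam segregators pushdown graphs DTIME n log n
NTIME separation" (6 docs, none on topic beyond the held
Santhanam CCC01 paper:doi-10-1109-ccc-2001-933895 read p.4 by the critic); lit search "segregator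
Santhanam nondeterministic" (3 docs: doi-10-1109-ccc-2001-933895
p.4, MW18 refs, Oliveira thesis p.250); lit galaxy search "segregator|multi-pushdown|depth-robust
graph" --star all and "segregators" --star pdf (0 relevant
hits); ledger negatives --problem PneNP (6, none on NTIME/DTIME/graphs); tree:
Theses/LightLogic.lean (stmt-PneNP-1642 NTIME(n) ⊄ DTIME(n²), the rung ABOVE
the shadow), WitnessCostSpaceLadder / RootDecompSpaceChain (space axis),
SoloInformedLinearLadder*.lean (the EQUIV), Literature PPST programme
(PaulPippengerSzemerediTrotter1983*.lean: segregator theorem proved, NTIME(n) ≠ DTIME(n) one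
hypothesis from closed).
Nearest prior art found: Santhanam 2001 Thm 2.7 itself (the conditional lift, conference sketch) and
lens-3's WitnessCostPlane (the fixed rung k = 2 with
PPST beneath); the cell's N1–N4 (law-D nodes on other axes).
Delta: the first root node whose non-residual side is driven down to a finite, barrier-free
graph-theoretic statement (segregator size of r-pushdown DAGs)
with a decided rung below and a refuted rung above, filed with its kill switch and an instrument —
at the declared price of a stronger residual.
Claimed grade: new-combination  [refs: paper:doi-10-1109-ccc-2001-933895, doi-10-1109-ccc-2001-933895]

Barriers (technique_class: uniform-diagonalization, segregators, graph-pebbling, padding): - technique_class: uniform-diagonalization, segregators, graph-pebbling, padding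
- Literature.Barriers.PneNP.Relativization: EqExpRungLog — the self-answering oracle gives
NTIME^O(t) ⊆ DTIME^O(t) at every t, so any proof of the shadow is non-relativizing; the segregator
road IS non-relativizing (tape-geometry / block-respecting simulation; PPST's theorem at t = n is
the standing example, Gasarch 1987 per census v3 T13) — evasion by technique class, not a bet;
EqExpResidual — declared residual, inherits the summit's oracle profile, priced never attacked;
SmallSegregators (road) — a graph statement, no oracle slot.
- Literature.Barriers.PneNP.NaturalProofs: outside for every item — uniform machine statements and a
finite-graph statement; no constructive largeness against P/poly anywhere on the line.
- Literature.Barriers.PneNP.Algebrization: EqExpRungLog sits below the scope of the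
Aaronson–Wigderson collapses (fixed time bound, uniform, structural simulation); EqExpResidual
priced as the summit.
- Literature.Barriers.PneNP.BoundedRelativization: prices EqExpResidual exactly as it prices the
summit; the shadow and the road sit below its range.
- Literature.Barriers.PneNP.MCSPKarpHardness: outside — no meta-complexity step.
- Shadow-rung catalogue (Literature/Barriers/PneNP/Ladder.lean R-S5 fixed-polynomial shadows, floor
PPST83): this route is the equal-exponent neighbour of R-S5 at t = n log n; BC9 ladder ceiling =
segregator road capped at n log n (decided log*, conditional l

History (route lifecycle, newest last):
- 2026-08-30T04:41:19Z · rev 3: informal re-worded for SmallSegregators, SmallSegregatorsAt3, SegregatorLift (planner-decomp-pnenp-writer-1-g3-0)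
- 2026-08-30T06:47:54Z · BROKEN — SmallSegregatorsAt3 (stmt-PneNP-27086, aside) refuted by Summit.PneNP.PneNP.Theorems.RootDecompSegregatorSmallSegregatorsAt3_refuted (refuter-decomp-pnenp-crit-1-g3-0)
- 2026-08-30T06:55:59Z · rev 8: dropped SmallSegregatorsAt3 — repair: SmallSegregatorsAt3 (stmt-PneNP-27086, kind aside) REFUTED in kernel by Summit.PneNP.PneNP.Theorems.RootDecompSegregatorSmallSegregatorsAt3_refuted (p76 (planner-decomp-pnenp-writer-1-g4-0)
- 2026-08-30T06:55:59Z · REPAIRED (drop SmallSegregatorsAt3) — back to draft: repair: SmallSegregatorsAt3 (stmt-PneNP-27086, kind aside) REFUTED in kernel by Summit.PneNP.PneNP.Theorems.RootDecompSegregatorSmallSegregatorsAt3_refuted (p76 (planner-decomp-pnenp-writer-1-g4-0)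
- 2026-08-30T06:59:47Z · BROKEN — SmallSegregators (stmt-PneNP-26297, crux) refuted by Summit.PneNP.PneNP.Theorems.RootDecompSegregatorSmallSegregators_refuted (refuter-decomp-pnenp-crit-1-g3-0)
- 2026-08-30T07:12:04Z · rev 9: dropped SmallSegregators — repair: SmallSegregators (stmt-PneNP-26297, the r-flat road item) REFUTED in kernel by Summit.PneNP.PneNP.Theorems.RootDecompSegregatorSmallSegregators_refuted (planner-decomp-pnenp-writer-1-g4-0)
- 2026-08-30T07:12:04Z · REPAIRED (drop SmallSegregators) — back to draft: repair: SmallSegregators (stmt-PneNP-26297, the r-flat road item) REFUTED in kernel by Summit.PneNP.PneNP.Theorems.RootDecompSegregatorSmallSegregators_refuted (planner-decomp-pnenp-writer-1-g4-0)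
- 2026-09-04T13:18:08Z · DORMANT — reconciler: no traction for 5 d (last activity statement-checked at 2026-08-30T12:31:19Z); parked, not closed — `ledger route dormant route-PneNP-RootDecompSegr (operator:999:3347317)

sub-problem: PneNP · status: dormant · opened planner-decomp-pnenp-writer-1-g2-0 2026-08-30T03:03:51Z · rev 9 · ledger route-PneNP-RootDecompSegregator
GENERATED by the gate from the ledger (D-0016/17). Provers cite these decls: `theorem foo : Summit.PneNP.PneNP.Theses.RootDecompSegregator.<Decl> := …` in Summits/PneNP/PneNP/Theorems/<Name>.lean.
-/

namespace Summit.PneNP.PneNP.Theses.RootDecompSegregator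

open scoped BigOperators Topology Manifold Classical MeasureTheory ProbabilityTheory Matrix InnerProductSpace ComplexConjugate ContinuousMap
open Filter Set Function TopologicalSpace MeasureTheory

attribute [summit_statement] _root_.PneNP

open Literature.PNP

/-! Retired items kept as plain definitions (history; not obligations of this route): landed proofs / closed glue still name them. -/

-- tombstone: stmt-PneNP-26297 was DROPPED from this route but is still named by active items / landed proofs — kept as a plain def (no route_item tag), not an obligation of this route
/-- retired stmt-PneNP-26297 (dropped, gen 1) — refuted by Summit.PneNP.PneNP.Theorems.RootDecompSegregatorSmallSegregators_refuted. -/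
def SmallSegregators : Prop :=
  ∀ r k : ℕ, ∃ N₀ : ℕ, ∀ N : ℕ, N₀ ≤ N → ∀ E : Finset (ℕ × ℕ), ((∀ e ∈ E, e.1 < e.2 ∧ e.2 < N) ∧ ∃ F : Fin r → Finset (ℕ × ℕ), (∀ m, (∀ e ∈ F m, e.1 < e.2) ∧ (∀ e₁ ∈ F m, ∀ e₂ ∈ F m, e₁.2 = e₂.2 → e₁ = e₂) ∧ (∀ e₁ ∈ F m, ∀ e₂ ∈ F m, e₁.1 < e₂.1 → e₂.1 < e₁.2 → e₂.2 ≤ e₁.2)) ∧ ∀ e ∈ E, e.2 = e.1 + 1 ∨ ∃ m, e ∈ F m) → ∃ J : Finset ℕ, (k + 1) * (J.card * (Nat.log 2 N + 1)) ≤ N ∧ ∀ v < N, v ∉ J → ({u | Relation.TransGen (fun a b => (a, b) ∈ E ∧ a ∉ J ∧ b ∉ J) u v} : Set ℕ).ncard ≤ N / (k + 1)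

-- tombstone: stmt-PneNP-27086 was DROPPED from this route but is still named by active items / landed proofs — kept as a plain def (no route_item tag), not an obligation of this route
/-- retired stmt-PneNP-27086 (dropped, gen None) — refuted by Summit.PneNP.PneNP.Theorems.RootDecompSegregatorSmallSegregatorsAt3_refuted. -/
def SmallSegregatorsAt3 : Prop :=
  ∀ k : ℕ, ∃ N₀ : ℕ, ∀ N : ℕ, N₀ ≤ N → ∀ E : Finset (ℕ × ℕ), ((∀ e ∈ E, e.1 < e.2 ∧ e.2 < N) ∧ ∃ F : Fin 3 → Finset (ℕ × ℕ), (∀ m, (∀ e ∈ F m, e.1 < e.2) ∧ (∀ e₁ ∈ F m, ∀ e₂ ∈ F m, e₁.2 = e₂.2 → e₁ = e₂) ∧ (∀ e₁ ∈ F m, ∀ e₂ ∈ F m, e₁.1 < e₂.1 → e₂.1 < e₁.2 → e₂.2 ≤ e₁.2)) ∧ ∀ e ∈ E, e.2 = e.1 + 1 ∨ ∃ m, e ∈ F m) → ∃ J : Finset ℕ, (k + 1) * (J.card * (Nat.log 2 N + 1)) ≤ N ∧ ∀ v < N, v ∉ J → ({u | Relation.TransGen (fun a b => (a, b) ∈ E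 ∧ a ∉ J ∧ b ∉ J) u v} : Set ℕ).ncard ≤ N / (k + 1)

/-- item stmt-PneNP-29213 · crux · rank 2 · open · by planner
why it might fail: Cannot fail short of P = NP (S ⟹ Sh* in kernel); as a target every known engine gives gain exactly log* n (PPST Thm 3, Gupta k=2) — one factor short after the translation loss; pebbling engines cap below log N (PPST Thm 5.1).
sources: Santhanam2001, PaulEtAl1983, AroraBarakCC2009, arXiv:2111.02138, corpus:paper-doi-10-1109-ccc-2001-933895 p.4
[crux] Sh* (REV 3, attacked; lens-1 g5 SpeedupWindow PIECE, critic CLEARED 2026-08-30T06:10:39Z as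
N7 repair content): nondeterministic time n·(log* n + 1) is not contained in deterministic time
n·(log* n + 1) on the tree's multi-stack machines (= DTIME(n log* n) ≠ NTIME(n log* n) of print,
O-slack built in; `logStar` = tree iterated logarithm). S-implied (lens kernel
`eqExpRungLogStar_of_pneNP` mod the routine constructibility conjunct `IsTimeConstructible t*`);
converse = the declared residual EqExpResidualStar; OPEN since Santhanam 2001 Thm 2.5 (which stops
at t = o(n log* n)); STRONGER-side neighbour: EqExpRungLog (26196, rung n log n) ⟹ Sh* by padding.
Leaf IDEA-NEEDED-with-TYPED-ROAD: Sh* ⟸ SpeedUpPolyLogStar (∃ k, DTIME(n·(log* n+1)³) ⊆ ΣₖLIN —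
UNDECIDED, inside PPST's open engine window (log*, log)) ∧ LogStarWindowData (TRUE-routine), glue
PROVED in the lens kernel (`eqExpRungLogStarGlue_holds` via `not_collapseAt_of_speedUp`, 0 sorry,
axioms standard); the road items are typed against the tree's `sigmaLin` (module
…PaulPippengerSzemerediTrotter1983Collapse farm-unbuilt) and are filed as a glued split when the
olean exists. Writer certificate n18_speedup/N7w1_items.lean (If -/
@[route_item "route-PneNP-RootDecompSegregator"]
def EqExpRungLogStar : Prop :=
  ¬ (Literature.Computability.Complexity.NTIME (fun n => n * (Literature.Computability.Complexity.logStar n + 1)) ⊆ Literature.Computability.Complexity.DTIME (fun n => n * (Literature.Computability.Complexity.logStar n + 1)))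

/-- item stmt-PneNP-29214 · crux · rank 3 · open · by planner
why it might fail: It is the summit in disguise whenever the shadow is a theorem: false iff DTIME(n log* n) ≠ NTIME(n log* n) ∧ P = NP, a conjunction consistent with all known results (oracle-false per census CLAIM C); no road in print.
sources: Santhanam2001, BakerGillSolovay1975, AaronsonWigderson2009, RazborovRudich1997, arXiv:2111.02138
[crux] C* (REV 3, DECLARED RESIDUAL; summit-hard by design; no score claimed): one equal-exponent
separation at the quasi-linear rung n·log* n lifts to P ≠ NP. S-implied trivially; false exactly if
DTIME(n log* n) ≠ NTIME(n log* n) but P = NP — consistent with everything known (relativized P = NP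
worlds, BGS75; census CLAIM C ORACLE-FALSE tag, confidence 0.8); formally STRONGER than
EqExpResidual 26197 (⟹ it mod window data) and than WCSL's CornerLift (the shadow moved DOWN:
zero-sum price declared); meets the alternation chain through 26197 ⟹ N14.UniformCollapse mod
FortnowCompounding. Inherits every barrier of the summit (relativization BGS75, algebrization AW09,
natural proofs RR97 n/a-uniform, bounded relativization). [deps: EqExpRungLogStar] [difficulty:
open-problem] -/
@[route_item "route-PneNP-RootDecompSegregator"]
def EqExpResidualStar : Prop :=
  EqExpRungLogStar → PneNP

/-- item stmt-PneNP-26196 · aside · rank 2 · SPLIT (gen 1) into SmallSegregators, SegregatorLift + glue EqExpRungLogGlue · direct attempts still welcome (low priority) · by planner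
why it might fail: Cannot fail short of P = NP (S ⟹ Sh); as a target open since 1983: segregator road refuted (K**), pebbling engines cap below log N (PPST Thm 5.1).
sources: Santhanam2001, PaulEtAl1983, arXiv:2111.02138, HomerSelman2011
retired/moot children: SmallSegregators [dropped: ∀ r k : ℕ, ∃ N₀ : ℕ, ∀ N : ℕ, N₀ ≤ N → ∀ E : Finset (ℕ × ℕ), ((∀ e ∈ E, e.1 < e.]
[crux] the SHADOW — nondeterministic time n·ℓn is not contained in deterministic time n·ℓn on the
tree's multi-stack machines (ℓn = ⌊log₂ n⌋ + 1; the classes carry O-slack, so this is DTIME(n log n)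
≠ NTIME(n log n) of print); S-implied (cell kernel `eqExpRungLog_of_pneNP` via the time-ladder
equivalence at k = 2 and `eqExpRungLog_of_quadTimeRung`), necessary, not costume (Sh ⟹ S unknown),
not law-A; leaf IDEA-NEEDED-with-TYPED-ROAD (the segregator road beneath, filed as a glued split
after birth: SmallSegregators → SegregatorLift → EqExpRungLog). [difficulty: open-problem] -/
@[route_item "route-PneNP-RootDecompSegregator"]
def EqExpRungLog : Prop :=
  ¬ (Literature.Computability.Complexity.NTIME (fun n => n * (Nat.log 2 n + 1)) ⊆ Literature.Computability.Complexity.DTIME (fun n => n * (Nat.log 2 n + 1)))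

-- parent: EqExpRungLog · child (gen 1)
/--     item stmt-PneNP-26298 · support · rank 202 · closed · proved by Summit.PneNP.PneNP.Theorems.segregatorLift_proof (prover)
    parent: EqExpRungLog · by planner
    why it might fail: Theorem in print (Santhanam 2001 Thm 2.7), conference sketch only; the kernel port must match the inline segregator typing ((k+1)|J|ℓN ≤ N, J-avoiding ancestors) and multitape ↦ TM2 — a model/constant mismatch forces a restatement, it does not kill the line.
    sources: Santhanam2001, PaulEtAl1983
[support → VACUOUS-TRUE once ¬SmallSegregators lands, rev-3 record] CHILD B of the split of
EqExpRungLog (26196): SmallSegregators → EqExpRungLog (Santhanam 2001 Thm 2.7/3.1 magnification: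
small segregators for all r ⟹ DTIME(n log n) ≠ NTIME(n log n); typed rev 1). Since 26297
SmallSegregators is REFUTED IN KERNEL (lens-1 v5 `not_smallSegregators`, critic CONFIRMED 04:36:36Z,
landing pending), this implication is vacuously true: `segregatorLift_vacuous : SegregatorLift`
(same file) — a one-liner AFTER the refutation lands, worth nothing toward 26196. NO prover before
the landing; afterwards close it --as proved by the vacuous proof only for bookkeeping; the split
26297/26298/26299 is to be REPLACED (--resplit by operator/tenure) or abandoned (26196 bare).
Sources: Santhanam2001, lens-1 v5 file. -/
@[route_item "route-PneNP-RootDecompSegregator"]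
def SegregatorLift : Prop :=
  SmallSegregators → EqExpRungLog

-- `SegregatorLift` holds: proved by `Summit.PneNP.PneNP.Theorems.segregatorLift_proof` (its module imports this route file, so no `_holds` link can be stated here).

-- parent: EqExpRungLog · glue (gen 1)
/--     item stmt-PneNP-26299 · support · rank 203 · closed · proved by Summit.PneNP.PneNP.Theorems.eqExpRungLogGlue_proof (prover)
    parent: EqExpRungLog · GLUE: children ⟹ parent · by planner
SmallSegregators → SegregatorLift → EqExpRungLog -/
@[route_item "route-PneNP-RootDecompSegregator"]
def EqExpRungLogGlue : Prop :=
  SmallSegregators → SegregatorLift → EqExpRungLog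

-- `EqExpRungLogGlue` holds: proved by `Summit.PneNP.PneNP.Theorems.eqExpRungLogGlue_proof` (its module imports this route file, so no `_holds` link can be stated here).

/-- item stmt-PneNP-26197 · aside · rank 3 · open · by planner
why it might fail: Summit-hard by design: false exactly if DTIME(n log n) ≠ NTIME(n log n) but P = NP — consistent with everything known; inherits relativization/algebrization.
sources: Santhanam2001, BakerGillSolovay1975, AaronsonWigderson2009, arXiv:2111.02138
[crux] the DECLARED RESIDUAL of the split — if NTIME(n·ℓn) ⊄ DTIME(n·ℓn) then P ≠ NP (the lift from
one equal-exponent separation at n log n to the whole polynomial ladder); S-implied trivially;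
carries the summit; no score under the critic's rule (v): formally STRONGER than (QuadTimeRung → S)
because the shadow moved DOWN (cell kernel `residual_stronger_down`; weakening it back needs the
open upward implication Sh → NTIME(n) ⊄ DTIME(n²)); leaf IDEA-NEEDED, barrier-priced as the summit.
[deps: EqExpRungLog] [difficulty: open-problem] -/
@[route_item "route-PneNP-RootDecompSegregator"]
def EqExpResidual : Prop :=
  EqExpRungLog → PneNP

/-- item stmt-PneNP-26198 · assembly · rank 1 · open · by planner
sources: Santhanam2001
[assembly] EqExpRungLog → EqExpResidual → PneNP (the deciding theorem `closes` proves exactly this). -/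
@[route_item "route-PneNP-RootDecompSegregator"]
def Assembly : Prop :=
  EqExpRungLog → EqExpResidual → PneNP

-- records of items no longer active in this route (dropped / restated):
-- earlier SmallSegregatorsAt3 (stmt-PneNP-27086, dropped 2026-08-30T06:55:59Z): refuted by Summit.PneNP.PneNP.Theorems.RootDecompSegregatorSmallSegregatorsAt3_refuted — ∀ k : ℕ, ∃ N₀ : ℕ, ∀ N : ℕ, N₀ ≤ N → ∀ E : Finset (ℕ × ℕ), ((∀ e ∈ E, e.1 < e.2 ∧ e.2 < N) ∧ ∃ F : Fin 3 → Finset (ℕ × ℕ), (∀ m, (∀ e ∈ F m, e.1 < e.2) ∧ (∀ e₁ ∈ F m, ∀ e₂ ∈ F m, e₁.2 = e₂.2 → e₁ = e₂) ∧ (∀ e₁ ∈ F m, ∀ e₂ ∈ F m, e₁.1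

/-! D-0027 §2.1 — DECIDING THEOREM (planner-authored via `route open/edit --closes-file`; by planner-decomp-pnenp-writer-1-g4-0 2026-08-30T06:21:06Z):
its hypotheses are this route's items and its conclusion the sub-problem Statement (glue_lint), and it elaborates with this file. -/

@[closes "route-PneNP-RootDecompSegregator"] theorem closes (hSh : EqExpRungLogStar) (hRes : EqExpResidualStar) : _root_.PneNP := hRes hSh

end Summit.PneNP.PneNP.Theses.RootDecompSegregator
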